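import Mathlib
import HarnessLib.Audit
import Summits.PneNP.PneNP.Theorems.PstarGapTwoReadersProof
import Summits.PneNP.PneNP.Theorems.PstarGraphQuadGapReduction

/-!
# The reader slice of the gap lemma IS the graph-quadratic gap conjecture (ROUND-24, around T24.11b / T24.19)

FRONTIER range-avoidance ladder, rung F-N3, ROUND 24 (cell `pnp-ideate`; restricted-model proof complexity — nothing here bears
on `P` versus `NP`).

Two reductions of the cell, put side by side:

* `reader_reduction` (the substitution of `PstarGapTwoReadersProof`, for ANY number of parity constraints): a minimal infeasible
  READER family `J` (every output has both XOR slots `J`-private) of a pure typed instance with simple overlaps and `MaxDegree Δ`,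
  under a constraint system `W`, yields an unsat, edge-minimal graph-quadratic system on the simple graph of its AND edges (maximum
  degree `≤ Δ`) with `|E| = |J|` and at most `|W|` constraints;
* `PstarGraphQuadGapReduction` (T24.11b): an unsat edge-minimal graph-quadratic system is the fibre `y = 0` of a reader family
  (`PstarGraphQuadGapInstance.inst`, degree `≤ Δ + 1`) that is minimal infeasible under the lifted constraints.

Hence `graphQuadGap_iff_readerGap`: the conjecture `PstarGraphQuadGap.GraphQuadGap` is EQUIVALENT to the reader slice of the crux
`PstarGapLemma.PstarGapLemmaSO` — "for every `Δ` some `K` bounds every minimal infeasible reader family by `K·|W|`" (stated with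
`MaxDegree` only; boundary expansion plays no role for readers).  So every kit search and every partial result on graph-quadratic
systems (T24.11a/T24.11c) is literally a statement about reader families, and conversely; the two-constraint case is
`PstarGapTwoReadersProof.card_le_eight` (T24.19, `8Δ²`), and `readerGap_one` gives the one-constraint reader bound `2Δ²` from T24.11a.
-/

set_option linter.dupNamespace false

open Finset Literature.Computability.Complexity
open Summit.PneNP.PneNP.Theorems.PstarTyped (Typed)
open Summit.PneNP.PneNP.Theorems.PstarSALevel (varSet SimpleOverlap)
open Summit.PneNP.PneNP.Theorems.PstarGapLemma (Sat Feasible MinInfeasible MaxDegree GapBound)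
open Summit.PneNP.PneNP.Theorems.PstarGraphQuadGap (Edge QCon qval QHolds Simple EdgeMaxDegree Supported Unsat EdgeMinimal quadCount
  GraphQuadGap)
open Summit.PneNP.PneNP.Theorems.PstarGraphQuadGapOne (graphQuadGapOne)
open Summit.PneNP.PneNP.Theorems.PstarGraphQuadGapInstance
open Summit.PneNP.PneNP.Theorems.PstarGraphQuadGapReduction (liftW card_liftW_le minInfeasible_univ)
open Summit.PneNP.PneNP.Theorems.PstarGapTwoReaders (IsReader)
open Summit.PneNP.PneNP.Theorems.PstarGapTwoReadersProof

namespace Summit.PneNP.PneNP.Theorems.PstarReaderGap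

variable {n m : ℕ}

/-- **The reader reduction, for any constraint system.**  A minimal infeasible reader family gives an unsat, edge-minimal
graph-quadratic system on the simple graph of its AND edges, of maximum degree `≤ Δ`, with `|E| = |J|` edges and at most `|W|`
constraints. -/
theorem reader_reduction {Δ : ℕ} (I : LocalMap 4 n m) (hI : I.IsPure xorAndPred) (hT : Typed I) (hS : SimpleOverlap I)
    (hD : MaxDegree Δ I) (y : Fin m → Bool) (W : Finset (Finset (Fin n) × Bool)) (J : Finset (Fin m))
    (hR : ∀ j ∈ J, IsReader I J j) (hmin : MinInfeasible I y W J) :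
    ∃ (E : Finset (Edge n)) (W' : Finset (QCon n)), Simple E ∧ EdgeMaxDegree Δ E ∧ Supported E W' ∧ Unsat W' ∧
      EdgeMinimal E W' ∧ J.card = E.card ∧ W'.card ≤ W.card := by
  classical
  refine ⟨J.image (edge I), W.image (qcon I J y), simple_edges I hI J, edgeMaxDegree_edges I hD J, ?_, ?_, ?_,
    (card_image_of_injOn fun g _ h _ he => edge_injective I hI hS he).symm, card_image_le⟩
  · -- supported
    intro w' hw'
    obtain ⟨w, -, rfl⟩ := mem_image.1 hw'
    rw [qcon_fst]
    exact image_subset_image (filter_subset _ _)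
  · -- unsat
    rintro ⟨a, ha⟩
    obtain ⟨z, hzJ, hzq⟩ := exists_solution_same_qval I hI hT hR y a
    refine hmin.1 ⟨z, fun w hw => ?_, hzJ⟩
    have hq : QHolds (qcon I J y w) z := by
      have := ha _ (mem_image_of_mem _ hw)
      unfold PstarGraphQuadGap.QHolds at this ⊢
      rw [hzq w]; exact this
    exact (qholds_of_solves I hI hS hR y w hzJ).1 hq
  · -- edge-minimal
    intro j hj
    obtain ⟨g₀, hg₀, rfl⟩ := mem_image.1 hj
    obtain ⟨z, hzW, hzJ⟩ := hmin.2 g₀ hg₀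
    have hviol : I.eval z g₀ ≠ y g₀ := by
      intro h
      exact hmin.1 ⟨z, hzW, fun g hg => if hgg : g = g₀ then hgg ▸ h else hzJ g (mem_erase.2 ⟨hgg, hg⟩)⟩
    refine ⟨z, fun w' hw' => ?_⟩
    obtain ⟨w, hw, rfl⟩ := mem_image.1 hw'
    rw [qholds_of_almost I hI hS hR y w hg₀ (fun g hg hne => hzJ g (mem_erase.2 ⟨hne, hg⟩)) hviol (hzW w hw), qcon_fst]
    simp only [mem_image, mem_filter, not_exists, not_and]
    constructor
    · intro h g hg he
      exact h (edge_injective I hI hS he ▸ hg.2)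
    · intro h hmem
      exact h g₀ ⟨hg₀, hmem⟩ rfl

/-- **Graph-quadratic gap ⇒ reader gap** (same `K`). -/
theorem readerGap_of_graphQuadGap (h : GraphQuadGap) (Δ : ℕ) :
    ∃ K : ℕ, ∀ (n m : ℕ) (I : LocalMap 4 n m), I.IsPure xorAndPred → Typed I → SimpleOverlap I → MaxDegree Δ I →
      ∀ (y : Fin m → Bool) (W : Finset (Finset (Fin n) × Bool)) (J : Finset (Fin m)),
        (∀ j ∈ J, IsReader I J j) → MinInfeasible I y W J → J.card ≤ K * W.card := by
  obtain ⟨K, hK⟩ := h Δ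
  refine ⟨K, fun n m I hI hT hS hD y W J hR hmin => ?_⟩
  obtain ⟨E, W', hSi, hΔ, hsup, hU, hM, hJE, hW'⟩ := reader_reduction I hI hT hS hD y W J hR hmin
  calc J.card = E.card := hJE
    _ ≤ K * W'.card := hK n E W' hSi hΔ hsup hU hM
    _ ≤ K * W.card := Nat.mul_le_mul_left K hW'

/-- Every output of the graph instance is a reader of every output set. -/
theorem isReader_inst {V : ℕ} (E : Finset (Edge V)) (J : Finset (Fin E.card)) (j : Fin E.card) : IsReader (inst E) J j := by
  intro s hs j' _ hne hv
  have h01 : s = 0 ∨ s = 1 := by fin_cases s <;> simp at hs ⊢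
  rcases h01 with rfl | rfl
  · rw [vars_zero, xv_mem_varSet_iff] at hv; exact hne hv
  · rw [vars_one, xv'_mem_varSet_iff] at hv; exact hne hv

/-- **Reader gap ⇒ graph-quadratic gap** (`K(Δ) := K_readers(Δ + 1)`, via the instance of `PstarGraphQuadGapInstance`). -/
theorem graphQuadGap_of_readerGap
    (h : ∀ Δ : ℕ, ∃ K : ℕ, ∀ (n m : ℕ) (I : LocalMap 4 n m), I.IsPure xorAndPred → Typed I → SimpleOverlap I → MaxDegree Δ I →
      ∀ (y : Fin m → Bool) (W : Finset (Finset (Fin n) × Bool)) (J : Finset (Fin m)),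
        (∀ j ∈ J, IsReader I J j) → MinInfeasible I y W J → J.card ≤ K * W.card) : GraphQuadGap := by
  intro Δ
  obtain ⟨K, hK⟩ := h (Δ + 1)
  refine ⟨K, fun V E W hS hΔ hsup hu hmin => ?_⟩
  have h1 := hK _ _ (inst E) (isPure_inst hS) typed_inst (simpleOverlap_inst hS) (maxDegree_inst hΔ) (fun _ => false)
    (liftW E W) univ (fun j _ => isReader_inst E univ j) (minInfeasible_univ hS hsup hu hmin)
  rw [card_univ, Fintype.card_fin] at h1
  exact h1.trans (Nat.mul_le_mul_left _ (card_liftW_le E W))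

/-- **The reader slice of the crux is the graph-quadratic gap conjecture.** -/
theorem graphQuadGap_iff_readerGap :
    GraphQuadGap ↔ ∀ Δ : ℕ, ∃ K : ℕ, ∀ (n m : ℕ) (I : LocalMap 4 n m), I.IsPure xorAndPred → Typed I → SimpleOverlap I →
      MaxDegree Δ I → ∀ (y : Fin m → Bool) (W : Finset (Finset (Fin n) × Bool)) (J : Finset (Fin m)),
        (∀ j ∈ J, IsReader I J j) → MinInfeasible I y W J → J.card ≤ K * W.card :=
  ⟨readerGap_of_graphQuadGap, graphQuadGap_of_readerGap⟩

/-! ## The one-constraint rung, read back on reader families -/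

/-- **One constraint (from T24.11a)**: a minimal infeasible reader family under at most one parity constraint has at most `2Δ²`
outputs.  (For boundary-expanding instances `GapOneAll` will give `0`; this bound needs no expansion.) -/
theorem readerGap_one {Δ : ℕ} (I : LocalMap 4 n m) (hI : I.IsPure xorAndPred) (hT : Typed I) (hS : SimpleOverlap I)
    (hD : MaxDegree Δ I) (y : Fin m → Bool) (W : Finset (Finset (Fin n) × Bool)) (J : Finset (Fin m)) (hW : W.card ≤ 1)
    (hR : ∀ j ∈ J, IsReader I J j) (hmin : MinInfeasible I y W J) : J.card ≤ 2 * Δ ^ 2 := by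
  obtain ⟨E, W', hSi, hΔ, hsup, hU, hM, hJE, hW'⟩ := reader_reduction I hI hT hS hD y W J hR hmin
  have hq : quadCount W' ≤ 1 := by
    unfold PstarGraphQuadGap.quadCount
    exact (card_filter_le _ _).trans (hW'.trans hW)
  calc J.card = E.card := hJE
    _ ≤ 2 * Δ ^ 2 * W'.card := graphQuadGapOne Δ n E W' hSi hΔ hsup hU hM hq
    _ ≤ 2 * Δ ^ 2 * 1 := Nat.mul_le_mul_left _ (hW'.trans hW)
    _ = 2 * Δ ^ 2 := Nat.mul_one _

end Summit.PneNP.PneNP.Theorems.PstarReaderGap
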